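import Summits.QuantumAdvantage.QuantumAdvantage.Theses.ArithStatLadder
import Literature.NumberTheory.QuadraticFields.ThreeTorsion
import Literature.NumberTheory.QuadraticFields.ScholzReflection
import Literature.NumberTheory.QuadraticFields.ScholzHeckeUnitCriterion
import Literature.NumberTheory.QuadraticFields.ScholzHeckeUnitCriterionProofs
import Summits.QuantumAdvantage.QuantumAdvantage.Theorems.AvgFaceBeyondPrior.Negative.AvgFaceBeyondPriorNecessary
import HarnessLib

/-!
# `AvgFaceBeyondPrior` in mirror coordinates: the exact transport `IQ3 = RealFace`
# (line `mirror-unit-signature` of crux stmt-QuantumAdvantage-2427, composition of skeleton v4)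

Topic: route `ArithStatLadder` of `QuantumAdvantage`, crux `AvgFaceBeyondPrior = ((IQ3, U) ∉ Heur_{1/3}BPP)` with
`IQ3 = {bin d : −d fundamental, 3 ∣ h(−d)}` (`Negative.iq3Set`, `Negative.Q`, `Negative.avgFace_iff_Q`).

Scholz's reflection theorem read with its unit defect says that, for `−d` fundamental and `d ≠ 3`,
`3 ∣ h(−d) ⟺ UnitCubeAtThree d ∨ #Cl₃(D⁺) ≠ 1`, `D⁺ = disc ℚ(√3d)` (`d/3` or `3d`), where `UnitCubeAtThree d`
(Literature, `ScholzHeckeUnitCriterion.lean`) is the arithmetic spelling of "the fundamental unit of `ℚ(√3d)` is a cube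
modulo `𝔓³` for every `𝔓 ∣ 3` of `ℚ(√3d, ζ₃)`". Consequently the crux is LITERALLY the statement that the real face
`RealFace = {d : −d fundamental, d ≠ 3, UnitCubeAtThree d ∨ #Cl₃(D⁺) ≠ 1}` is `Heur_{1/3}BPP`-hard on the route's
ensemble `U = Negative.ens`.

This file proves that transport sorry-free, with the classical inputs as explicit hypotheses in the SHARPEST form the
argument uses:
* `hleft` — the left inequality `#Cl₃(D⁺) ≤ #Cl₃(−d)` of Scholz's theorem (`Scholz1932_reflection.left`);
* `hii`   — direction (ii) of the Scholz–Hecke unit criterion (`ScholzHecke_unitCubeCriterion.three_dvd_imp_cube`);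
direction (i) is USED AS A THEOREM (`ScholzHecke.cube_imp_three_dvd`, ScholzHeckeUnitCriterionProofs.lean).

Main statements (namespace `…Theorems.AvgFaceBeyondPrior.Mirror`):
* `mem_iq3Set_iff_realFace_of` — `d ∈ IQ3 ↔ d ∈ RealFace`, pointwise, from `hleft`, `hii`;
* `avgFaceBeyondPrior_iff_realFaceHard_of` — `AvgFaceBeyondPrior ↔ ((RealFace, U) ∉ Heur_{1/3}BPP)` from `hleft`, `hii`;
* `avgFaceBeyondPrior_iff_realFaceHard_of_facts` — the same from the two Literature named facts
  `Scholz1932_reflection`, `ScholzHecke_unitCubeCriterion` (conditional result; becomes unconditional by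
  `… Scholz1932_reflection_holds ScholzHecke_unitCubeCriterion_holds` the day both are discharged);
* `unitCube_subset_iq3Set` — UNCONDITIONAL already: the unit language `L_ε = {−d fund., d ≠ 3, UnitCubeAtThree d}`
  (the GRH-free BQP witness of shape M, route item `UnitCubeMemBQP`) is contained in `IQ3`.

References: A. Scholz, J. reine angew. Math. 166 (1932) 201–203 [Scholz1932]; L. C. Washington, *Introduction to
Cyclotomic Fields*, GTM 83, Thm 10.10 and its proof [Washington1997]; A. Bogdanov, L. Trevisan, *Average-case
complexity*, §2.3 (heuristic classes) [BogdanovTrevisan2006].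
-/

noncomputable section

open scoped Classical

namespace Summit.QuantumAdvantage.QuantumAdvantage.Theorems.AvgFaceBeyondPrior.Mirror

open _root_.Computability
open Literature.Computability.Complexity Literature.Computability.MetaComplexity
  Literature.NumberTheory.QuadraticFields
open Summit.QuantumAdvantage.QuantumAdvantage.Theses.ArithStatLadder
open Summit.QuantumAdvantage.QuantumAdvantage.Theorems.AvgFaceBeyondPrior

/-- `h(−3) = 1`, so `3 ∤ h(−3)`: the degenerate point `d = 3` (`D⁺ = 1`) lies outside `IQ3`. [folklore] -/
theorem not_three_dvd_classNumber_neg_three : ¬ (3 ∣ BinaryQuadraticForm.classNumber (-3)) := by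
  decide

/-- A `d` with `−d` a fundamental discriminant is positive. [folklore] -/
theorem pos_of_isNegFund {d : ℕ}
    (h : (((-(d:ℤ)) % 4 = 1 ∧ Squarefree (-(d:ℤ)) ∧ (-(d:ℤ)) ≠ 1) ∨
      (4 ∣ (-(d:ℤ)) ∧ ((-(d:ℤ)) / 4 % 4 = 2 ∨ (-(d:ℤ)) / 4 % 4 = 3) ∧ Squarefree ((-(d:ℤ)) / 4)))) :
    0 < d := by
  rcases Nat.eq_zero_or_pos d with rfl | hpos
  · rcases h with h | h <;> norm_num at h
  · exact hpos

/-- **The unit language lies inside `IQ3`, unconditionally**: for `−d` fundamental, `d ≠ 3`, `UnitCubeAtThree d`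
forces `3 ∣ h(−d)` — direction (i) of the Scholz–Hecke criterion, PROVED in the tree
(`ScholzHecke.cube_imp_three_dvd`: Kummer theory, Hecke Satz 119, Artin reciprocity). So the GRH-free `BQP` witness
`L_ε` of shape M never claims a non-member of `IQ3`. [cite: Washington1997, Thm 10.10 (proof)] -/
theorem unitCube_subset_iq3Set :
    {d : ℕ | ((((-(d:ℤ)) % 4 = 1 ∧ Squarefree (-(d:ℤ)) ∧ (-(d:ℤ)) ≠ 1) ∨
        (4 ∣ (-(d:ℤ)) ∧ ((-(d:ℤ)) / 4 % 4 = 2 ∨ (-(d:ℤ)) / 4 % 4 = 3) ∧ Squarefree ((-(d:ℤ)) / 4))) ∧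
        d ≠ 3 ∧ UnitCubeAtThree d)} ⊆ Negative.iq3Set := by
  rintro d ⟨hf, h3, hu⟩
  exact ⟨hf, ScholzHecke.cube_imp_three_dvd hf h3 hu⟩

/-- Off the degenerate point, a nontrivial `3`-torsion class of `ℚ(√3d)` forces `3 ∣ h(−d)`, given Scholz's left
inequality `#Cl₃(D⁺) ≤ #Cl₃(−d)` (then Cauchy in `Cl(ℚ(√−d))` through the PROVED bridge
`three_dvd_classNumber_iff_one_lt_quadFieldThreeTorsion`). [cite: Washington1997, Thm 10.10] -/
theorem three_dvd_classNumber_of_mirrorTorsion_ne_one_of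
    (hleft : ∀ d : ℕ, ((((-(d:ℤ)) % 4 = 1 ∧ Squarefree (-(d:ℤ)) ∧ (-(d:ℤ)) ≠ 1) ∨
        (4 ∣ (-(d:ℤ)) ∧ ((-(d:ℤ)) / 4 % 4 = 2 ∨ (-(d:ℤ)) / 4 % 4 = 3) ∧ Squarefree ((-(d:ℤ)) / 4)))) →
      quadFieldThreeTorsion (if 3 ∣ d then ((d / 3 : ℕ) : ℤ) else 3 * (d : ℤ)) ≤
        quadFieldThreeTorsion (-(d:ℤ)))
    {d : ℕ}
    (hf : (((-(d:ℤ)) % 4 = 1 ∧ Squarefree (-(d:ℤ)) ∧ (-(d:ℤ)) ≠ 1) ∨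
      (4 ∣ (-(d:ℤ)) ∧ ((-(d:ℤ)) / 4 % 4 = 2 ∨ (-(d:ℤ)) / 4 % 4 = 3) ∧ Squarefree ((-(d:ℤ)) / 4))))
    (ht : quadFieldThreeTorsion (if 3 ∣ d then ((d / 3 : ℕ) : ℤ) else 3 * (d : ℤ)) ≠ 1) :
    3 ∣ BinaryQuadraticForm.classNumber (-(d:ℤ)) := by
  have hle := hleft d hf
  have hpos := quadFieldThreeTorsion_pos (if 3 ∣ d then ((d / 3 : ℕ) : ℤ) else 3 * (d : ℤ))
  have hneg : (-(d:ℤ)) < 0 := by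
    have := pos_of_isNegFund hf
    omega
  rw [three_dvd_classNumber_iff_one_lt_quadFieldThreeTorsion hf hneg]
  omega

/-- **`IQ3 = RealFace` pointwise**, from Scholz's left inequality `hleft` and direction (ii) `hii` of the unit
criterion (direction (i) is the tree theorem `ScholzHecke.cube_imp_three_dvd`): `d ∈ IQ3` iff `−d` is fundamental,
`d ≠ 3`, and the mirror unit is a cube at `3` or `#Cl₃(D⁺) ≠ 1`. [cite: Scholz1932, pp. 201–203] -/
theorem mem_iq3Set_iff_realFace_of
    (hleft : ∀ d : ℕ, ((((-(d:ℤ)) % 4 = 1 ∧ Squarefree (-(d:ℤ)) ∧ (-(d:ℤ)) ≠ 1) ∨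
        (4 ∣ (-(d:ℤ)) ∧ ((-(d:ℤ)) / 4 % 4 = 2 ∨ (-(d:ℤ)) / 4 % 4 = 3) ∧ Squarefree ((-(d:ℤ)) / 4)))) →
      quadFieldThreeTorsion (if 3 ∣ d then ((d / 3 : ℕ) : ℤ) else 3 * (d : ℤ)) ≤
        quadFieldThreeTorsion (-(d:ℤ)))
    (hii : ∀ d : ℕ, ((((-(d:ℤ)) % 4 = 1 ∧ Squarefree (-(d:ℤ)) ∧ (-(d:ℤ)) ≠ 1) ∨
        (4 ∣ (-(d:ℤ)) ∧ ((-(d:ℤ)) / 4 % 4 = 2 ∨ (-(d:ℤ)) / 4 % 4 = 3) ∧ Squarefree ((-(d:ℤ)) / 4)))) →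
      d ≠ 3 → quadFieldThreeTorsion (if 3 ∣ d then ((d / 3 : ℕ) : ℤ) else 3 * (d : ℤ)) = 1 →
        3 ∣ BinaryQuadraticForm.classNumber (-(d:ℤ)) → UnitCubeAtThree d)
    (d : ℕ) :
    d ∈ Negative.iq3Set ↔
      d ∈ {d : ℕ | ((((-(d:ℤ)) % 4 = 1 ∧ Squarefree (-(d:ℤ)) ∧ (-(d:ℤ)) ≠ 1) ∨
        (4 ∣ (-(d:ℤ)) ∧ ((-(d:ℤ)) / 4 % 4 = 2 ∨ (-(d:ℤ)) / 4 % 4 = 3) ∧ Squarefree ((-(d:ℤ)) / 4))) ∧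
        d ≠ 3 ∧ (UnitCubeAtThree d ∨
          quadFieldThreeTorsion (if 3 ∣ d then ((d / 3 : ℕ) : ℤ) else 3 * (d : ℤ)) ≠ 1))} := by
  simp only [Negative.iq3Set, Set.mem_setOf_eq]
  constructor
  · rintro ⟨hf, hdvd⟩
    have hne : d ≠ 3 := by
      rintro rfl
      exact not_three_dvd_classNumber_neg_three hdvd
    refine ⟨hf, hne, ?_⟩
    by_cases ht : quadFieldThreeTorsion (if 3 ∣ d then ((d / 3 : ℕ) : ℤ) else 3 * (d : ℤ)) = 1
    · exact Or.inl (hii d hf hne ht hdvd)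
    · exact Or.inr ht
  · rintro ⟨hf, hne, hc | ht⟩
    · exact ⟨hf, ScholzHecke.cube_imp_three_dvd hf hne hc⟩
    · exact ⟨hf, three_dvd_classNumber_of_mirrorTorsion_ne_one_of hleft hf ht⟩

/-- **The crux in mirror coordinates** (composition of skeleton v4 of the line `mirror-unit-signature`): given
Scholz's left inequality and direction (ii) of the unit criterion, `AvgFaceBeyondPrior` holds IFF the real-face
problem `(RealFace, U)` is not in `Heur_{1/3}BPP` — the two distributional problems are EQUAL (`Negative.Q` rewritten
along `IQ3 = RealFace`). The right-hand side is the registered hypothesis-type stub `stub_realFaceHard` verbatim.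
[cite: BogdanovTrevisan2006, §2.3] -/
theorem avgFaceBeyondPrior_iff_realFaceHard_of :
    (∀ d : ℕ, ((((-(d:ℤ)) % 4 = 1 ∧ Squarefree (-(d:ℤ)) ∧ (-(d:ℤ)) ≠ 1) ∨
        (4 ∣ (-(d:ℤ)) ∧ ((-(d:ℤ)) / 4 % 4 = 2 ∨ (-(d:ℤ)) / 4 % 4 = 3) ∧ Squarefree ((-(d:ℤ)) / 4)))) →
      quadFieldThreeTorsion (if 3 ∣ d then ((d / 3 : ℕ) : ℤ) else 3 * (d : ℤ)) ≤
        quadFieldThreeTorsion (-(d:ℤ))) →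
    (∀ d : ℕ, ((((-(d:ℤ)) % 4 = 1 ∧ Squarefree (-(d:ℤ)) ∧ (-(d:ℤ)) ≠ 1) ∨
        (4 ∣ (-(d:ℤ)) ∧ ((-(d:ℤ)) / 4 % 4 = 2 ∨ (-(d:ℤ)) / 4 % 4 = 3) ∧ Squarefree ((-(d:ℤ)) / 4)))) →
      d ≠ 3 → quadFieldThreeTorsion (if 3 ∣ d then ((d / 3 : ℕ) : ℤ) else 3 * (d : ℤ)) = 1 →
        3 ∣ BinaryQuadraticForm.classNumber (-(d:ℤ)) → UnitCubeAtThree d) →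
    (Summit.QuantumAdvantage.QuantumAdvantage.Theses.ArithStatLadder.AvgFaceBeyondPrior ↔
      (⟨encodingNatBool.toLanguage {d : ℕ | ((((-(d:ℤ)) % 4 = 1 ∧ Squarefree (-(d:ℤ)) ∧ (-(d:ℤ)) ≠ 1) ∨
          (4 ∣ (-(d:ℤ)) ∧ ((-(d:ℤ)) / 4 % 4 = 2 ∨ (-(d:ℤ)) / 4 % 4 = 3) ∧ Squarefree ((-(d:ℤ)) / 4))) ∧
          d ≠ 3 ∧ (UnitCubeAtThree d ∨
            quadFieldThreeTorsion (if 3 ∣ d then ((d / 3 : ℕ) : ℤ) else 3 * (d : ℤ)) ≠ 1))},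
        Negative.ens⟩ : DistProblem) ∉ HeurDeltaBPP (fun _ => (1 : ℝ) / 3)) := by
  intro hleft hii
  have hset : Negative.iq3Set =
      {d : ℕ | ((((-(d:ℤ)) % 4 = 1 ∧ Squarefree (-(d:ℤ)) ∧ (-(d:ℤ)) ≠ 1) ∨
        (4 ∣ (-(d:ℤ)) ∧ ((-(d:ℤ)) / 4 % 4 = 2 ∨ (-(d:ℤ)) / 4 % 4 = 3) ∧ Squarefree ((-(d:ℤ)) / 4))) ∧
        d ≠ 3 ∧ (UnitCubeAtThree d ∨
          quadFieldThreeTorsion (if 3 ∣ d then ((d / 3 : ℕ) : ℤ) else 3 * (d : ℤ)) ≠ 1))} :=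
    Set.ext (mem_iq3Set_iff_realFace_of hleft hii)
  have hQ : Negative.Q =
      (⟨encodingNatBool.toLanguage {d : ℕ | ((((-(d:ℤ)) % 4 = 1 ∧ Squarefree (-(d:ℤ)) ∧ (-(d:ℤ)) ≠ 1) ∨
          (4 ∣ (-(d:ℤ)) ∧ ((-(d:ℤ)) / 4 % 4 = 2 ∨ (-(d:ℤ)) / 4 % 4 = 3) ∧ Squarefree ((-(d:ℤ)) / 4))) ∧
          d ≠ 3 ∧ (UnitCubeAtThree d ∨
            quadFieldThreeTorsion (if 3 ∣ d then ((d / 3 : ℕ) : ℤ) else 3 * (d : ℤ)) ≠ 1))},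
        Negative.ens⟩ : DistProblem) := by
    show (⟨encodingNatBool.toLanguage Negative.iq3Set, Negative.ens⟩ : DistProblem) = _
    rw [hset]
  rw [Negative.avgFace_iff_Q, hQ]

/-- **The crux in mirror coordinates, from the two Literature named facts** `Scholz1932_reflection` (Scholz 1932 =
Washington Thm 10.10) and `ScholzHecke_unitCubeCriterion` (its unit defect, Hecke Satz 118–119): conditional on them,
`AvgFaceBeyondPrior ↔ ((RealFace, U) ∉ Heur_{1/3}BPP)`. Unconditional the day both `_holds` theorems land
(direction (i) of the criterion already has: `ScholzHecke.cube_imp_three_dvd`). [cite: Washington1997, Thm 10.10] -/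
theorem avgFaceBeyondPrior_iff_realFaceHard_of_facts (h1 : Scholz1932_reflection)
    (h2 : ScholzHecke_unitCubeCriterion) :
    Summit.QuantumAdvantage.QuantumAdvantage.Theses.ArithStatLadder.AvgFaceBeyondPrior ↔
      (⟨encodingNatBool.toLanguage {d : ℕ | ((((-(d:ℤ)) % 4 = 1 ∧ Squarefree (-(d:ℤ)) ∧ (-(d:ℤ)) ≠ 1) ∨
          (4 ∣ (-(d:ℤ)) ∧ ((-(d:ℤ)) / 4 % 4 = 2 ∨ (-(d:ℤ)) / 4 % 4 = 3) ∧ Squarefree ((-(d:ℤ)) / 4))) ∧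
          d ≠ 3 ∧ (UnitCubeAtThree d ∨
            quadFieldThreeTorsion (if 3 ∣ d then ((d / 3 : ℕ) : ℤ) else 3 * (d : ℤ)) ≠ 1))},
        Negative.ens⟩ : DistProblem) ∉ HeurDeltaBPP (fun _ => (1 : ℝ) / 3) :=
  avgFaceBeyondPrior_iff_realFaceHard_of (fun _ hd => h1.left hd) (fun _ hd h3 ht hh => h2.three_dvd_imp_cube hd h3 ht hh)

end Summit.QuantumAdvantage.QuantumAdvantage.Theorems.AvgFaceBeyondPrior.Mirror

end
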